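import Mathlib.Tactic
import HarnessLib

/-!
# Proof by reflection for large polynomial certificates (cell `pub-zeta5`, P1)

HONEST FRAMING: systematic search; no irrationality claim unless certified.

OUR infrastructure (Summit side), P1 seat generation 2. Creative-telescoping certificates for the cell's hypergeometric
families are polynomial identities in two variables `(n, t)` whose expanded forms have thousands of monomials with
40-digit coefficients — beyond `ring` (kernel memory) and even beyond elaboration of the expanded statement (measured:
`HOME/pub-zeta5-p1/CT-PLAYBOOK.md`). This file provides a tiny COMPUTABLE algebra of dense bivariate integer polynomials
(`Poly2 = List (List ℤ)`, coefficient of `t^j` = list of coefficients in `n`) with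

* evaluation `ev2 p n t : ℚ` and the operations `add2`, `neg2`, `sub2`, `smul2`, `mul2`, `pow2`, `shift2` (`t ↦ t+1`),
  `cst2`/`lin2` (constants and linear forms `a·n + b·t + c`),
* the evaluation lemmas `ev2_add2`, …, `ev2_shift2` (each by a short induction), and
* `ev2_eq_zero_of_isZero2`: if all stored coefficients are `0` (a `decide`-able Boolean test) the polynomial evaluates to `0`.

USAGE: to prove a huge identity `L(n,t) = R(n,t)` between products/sums of linear forms and explicit certificate data, build
the syntax tree `E : Poly2` with these operations, check `isZero2 (sub2 EL ER) = true` by `decide +kernel` (bigint arithmetic in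
the kernel), and rewrite `ev2` through the evaluation lemmas down to opaque atoms; no `ring` call ever sees the expanded polynomial.
-/

namespace Summit.KontsevichZagierPeriods.Zeta5Search.PolyReflect

/-! ### Univariate dense polynomials over `ℤ` (variable `n`) -/

/-- Horner evaluation of a coefficient list (constant term first) at `x`. -/
def ev1 : List ℤ → ℚ → ℚ
  | [], _ => 0
  | a :: p, x => (a : ℚ) + x * ev1 p x

/-- Coefficientwise sum. -/
def add1 : List ℤ → List ℤ → List ℤ
  | [], q => q
  | p, [] => p
  | a :: p, b :: q => (a + b) :: add1 p q

/-- Scalar multiple. -/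
def smul1 (c : ℤ) : List ℤ → List ℤ
  | [] => []
  | a :: p => (c * a) :: smul1 c p

/-- Product (schoolbook). -/
def mul1 : List ℤ → List ℤ → List ℤ
  | [], _ => []
  | a :: p, q => add1 (smul1 a q) (0 :: mul1 p q)

/-- All coefficients vanish. -/
def isZero1 : List ℤ → Bool
  | [] => true
  | a :: p => (a == 0) && isZero1 p

/-- `ev1 [] = 0`. -/
@[simp] theorem ev1_nil (x : ℚ) : ev1 [] x = 0 := rfl
/-- `ev1` of a cons (Horner step). -/
@[simp] theorem ev1_cons (a : ℤ) (p : List ℤ) (x : ℚ) : ev1 (a :: p) x = (a : ℚ) + x * ev1 p x := rfl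

/-- `ev1` is additive. -/
theorem ev1_add1 : ∀ (p q : List ℤ) (x : ℚ), ev1 (add1 p q) x = ev1 p x + ev1 q x
  | [], q, x => by simp [add1]
  | a :: p, [], x => by simp [add1]
  | a :: p, b :: q, x => by
    simp only [add1, ev1_cons, ev1_add1 p q x, Int.cast_add]; ring

/-- `ev1` of a scalar multiple. -/
theorem ev1_smul1 (c : ℤ) : ∀ (p : List ℤ) (x : ℚ), ev1 (smul1 c p) x = (c : ℚ) * ev1 p x
  | [], x => by simp [smul1]
  | a :: p, x => by simp only [smul1, ev1_cons, ev1_smul1 c p x, Int.cast_mul]; ring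

/-- `ev1` is multiplicative. -/
theorem ev1_mul1 : ∀ (p q : List ℤ) (x : ℚ), ev1 (mul1 p q) x = ev1 p x * ev1 q x
  | [], q, x => by simp [mul1]
  | a :: p, q, x => by
    simp only [mul1, ev1_add1, ev1_smul1, ev1_cons, ev1_mul1 p q x, Int.cast_zero]; ring

/-- Vanishing coefficients give the zero function. -/
theorem ev1_eq_zero_of_isZero1 : ∀ (p : List ℤ) (x : ℚ), isZero1 p = true → ev1 p x = 0
  | [], x, _ => rfl
  | a :: p, x, h => by
    simp only [isZero1, Bool.and_eq_true, beq_iff_eq] at h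
    simp [h.1, ev1_eq_zero_of_isZero1 p x h.2]

/-! ### Bivariate dense polynomials: lists (in `t`) of univariate polynomials (in `n`) -/

/-- Dense bivariate integer polynomials: the `j`-th entry is the coefficient of `t^j`, a polynomial in `n`. -/
abbrev Poly2 := List (List ℤ)

/-- Evaluation at `(n, t)` (Horner in `t`). -/
def ev2 : Poly2 → ℚ → ℚ → ℚ
  | [], _, _ => 0
  | a :: p, n, t => ev1 a n + t * ev2 p n t

/-- Sum. -/
def add2 : Poly2 → Poly2 → Poly2
  | [], q => q
  | p, [] => p
  | a :: p, b :: q => add1 a b :: add2 p q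

/-- Multiplication by a polynomial in `n` alone. -/
def smul2 (c : List ℤ) : Poly2 → Poly2
  | [] => []
  | a :: p => mul1 c a :: smul2 c p

/-- Product. -/
def mul2 : Poly2 → Poly2 → Poly2
  | [], _ => []
  | a :: p, q => add2 (smul2 a q) ([] :: mul2 p q)

/-- Negation and difference. -/
def neg2 (p : Poly2) : Poly2 := smul2 [-1] p

/-- Difference. -/
def sub2 (p q : Poly2) : Poly2 := add2 p (neg2 q)

/-- Powers. -/
def pow2 (p : Poly2) : ℕ → Poly2
  | 0 => [[1]]
  | k + 1 => mul2 p (pow2 p k)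

/-- The shift `t ↦ t + 1`. -/
def shift2 : Poly2 → Poly2
  | [] => []
  | a :: p => add2 [a] (mul2 [[1], [1]] (shift2 p))

/-- The linear form `a·n + b·t + c`. -/
def lin2 (a b c : ℤ) : Poly2 := [[c, a], [b]]

/-- All stored coefficients vanish. -/
def isZero2 : Poly2 → Bool
  | [] => true
  | a :: p => isZero1 a && isZero2 p

/-- `ev2 [] = 0`. -/
@[simp] theorem ev2_nil (n t : ℚ) : ev2 [] n t = 0 := rfl
/-- `ev2` of a cons (Horner step in `t`). -/
@[simp] theorem ev2_cons (a : List ℤ) (p : Poly2) (n t : ℚ) : ev2 (a :: p) n t = ev1 a n + t * ev2 p n t := rfl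

/-- `ev2` is additive. -/
theorem ev2_add2 : ∀ (p q : Poly2) (n t : ℚ), ev2 (add2 p q) n t = ev2 p n t + ev2 q n t
  | [], q, n, t => by simp [add2]
  | a :: p, [], n, t => by simp [add2]
  | a :: p, b :: q, n, t => by simp only [add2, ev2_cons, ev1_add1, ev2_add2 p q n t]; ring

/-- `ev2` of an `n`-scalar multiple. -/
theorem ev2_smul2 (c : List ℤ) : ∀ (p : Poly2) (n t : ℚ), ev2 (smul2 c p) n t = ev1 c n * ev2 p n t
  | [], n, t => by simp [smul2]
  | a :: p, n, t => by simp only [smul2, ev2_cons, ev1_mul1, ev2_smul2 c p n t]; ring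

/-- `ev2` is multiplicative. -/
theorem ev2_mul2 : ∀ (p q : Poly2) (n t : ℚ), ev2 (mul2 p q) n t = ev2 p n t * ev2 q n t
  | [], q, n, t => by simp [mul2]
  | a :: p, q, n, t => by
    simp only [mul2, ev2_add2, ev2_smul2, ev2_cons, ev1_nil, ev2_mul2 p q n t]; ring

/-- `ev2` of the negation. -/
theorem ev2_neg2 (p : Poly2) (n t : ℚ) : ev2 (neg2 p) n t = -ev2 p n t := by
  simp [neg2, ev2_smul2]

/-- `ev2` of the difference. -/
theorem ev2_sub2 (p q : Poly2) (n t : ℚ) : ev2 (sub2 p q) n t = ev2 p n t - ev2 q n t := by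
  simp [sub2, ev2_add2, ev2_neg2]; ring

/-- `ev2` of a power. -/
theorem ev2_pow2 (p : Poly2) (n t : ℚ) : ∀ k : ℕ, ev2 (pow2 p k) n t = ev2 p n t ^ k
  | 0 => by simp [pow2]
  | k + 1 => by rw [pow2, ev2_mul2, ev2_pow2 p n t k]; ring

/-- `ev2` of the shift: `ev2 (shift2 p) n t = ev2 p n (t+1)`. -/
theorem ev2_shift2 : ∀ (p : Poly2) (n t : ℚ), ev2 (shift2 p) n t = ev2 p n (t + 1)
  | [], n, t => by simp [shift2]
  | a :: p, n, t => by
    rw [shift2, ev2_add2, ev2_mul2, ev2_shift2 p n t]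
    simp only [ev2_cons, ev2_nil, ev1_cons, ev1_nil, Int.cast_one]
    ring

/-- `ev2` of a linear form. -/
@[simp] theorem ev2_lin2 (a b c : ℤ) (n t : ℚ) : ev2 (lin2 a b c) n t = (a : ℚ) * n + (b : ℚ) * t + (c : ℚ) := by
  simp [lin2]; ring

/-- Vanishing coefficients give the zero function. -/
theorem ev2_eq_zero_of_isZero2 : ∀ (p : Poly2) (n t : ℚ), isZero2 p = true → ev2 p n t = 0
  | [], n, t, _ => rfl
  | a :: p, n, t, h => by
    simp only [isZero2, Bool.and_eq_true] at h
    simp [ev1_eq_zero_of_isZero1 a n h.1, ev2_eq_zero_of_isZero2 p n t h.2]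

/-- **Reflection principle**: `isZero2 (sub2 p q)` certifies `ev2 p = ev2 q`. -/
theorem ev2_eq_of_isZero2_sub2 (p q : Poly2) (h : isZero2 (sub2 p q) = true) (n t : ℚ) :
    ev2 p n t = ev2 q n t := by
  have := ev2_eq_zero_of_isZero2 _ n t h
  rw [ev2_sub2] at this
  linarith

/-! ### A small self-test (the corner contiguity certificate of `WedgeDictionaryCornerTransfer.gosper_contig`) -/

/-- `y_n(t) = −(84(n+1)⁴ + 240(n+1)³t + 270(n+1)²t² + 140(n+1)t³ + 28t⁴)` as data. -/
def yData : Poly2 :=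
  [[-84, -336, -504, -336, -84], [-240, -720, -720, -240], [-270, -540, -270], [-140, -140], [-28]]

/-- The two sides of `gosper_contig` as syntax trees. -/
def contigL : Poly2 :=
  add2 (mul2 (mul2 (add2 (mul2 (mul2 [[28, 84]] (lin2 0 1 1)) (lin2 1 1 1)) [[8, 42, 88, 82]])
    (lin2 1 2 2)) (pow2 (lin2 1 1 2) 6)) (mul2 [[2, 18, 72, 168, 252, 252, 168, 72, 18, 2]] (lin2 1 2 3))

/-- Right-hand side `(t+1)⁶ y(t+1) − (t+n+2)⁶ y(t)`. -/
def contigR : Poly2 :=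
  sub2 (mul2 (pow2 (lin2 0 1 1) 6) (shift2 yData)) (mul2 (pow2 (lin2 1 1 2) 6) yData)

/-- The corner contiguity identity re-proved by reflection (kernel `decide`), as a test of the machinery. -/
theorem contig_by_reflection (n t : ℚ) : ev2 contigL n t = ev2 contigR n t :=
  ev2_eq_of_isZero2_sub2 _ _ (by decide +kernel) n t

end Summit.KontsevichZagierPeriods.Zeta5Search.PolyReflect
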